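import Mathlib
import Literature.Analysis.FluidPDE.PeriodicNSOrbitPersistsProofs
import Summits.AnomalousDissipation.AnomalousDissipation.Theorems.TaylorCertificatesPacketLemmaFejer
import HarnessLib

/-!
# Route `WazewskiBlock`, crux `UniformWorkFloorTrap` (stmt-AnomalousDissipation-10353), line
# `work-lipschitz-cycles`: tools for the time-Fourier dictionary `stub_coeffCurveODE`

Definition-free helper file (lead a1).  The registered stub `stub_coeffCurveODE` of the line
skeleton `Cruxes/UniformWorkFloorTrap/Lines/work_lipschitz_cycles.lean` turns a solution `c(n,k)` of
the spatially truncated space–time lattice equation into a solution of the Galerkin ODE by summing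
the time series `t ↦ ∑ₙ eₙ(ωt) c(n,k)`.  This file supplies the one-dimensional Fourier-series
calculus that proof needs:

* `tsum_fourier_mul_tsum_fourier_mul` — the Cauchy product on `ℤ`:
  `(∑ₙ eₙ(x) aₙ)(∑ₙ eₙ(x) bₙ) = ∑ₙ eₙ(x) ∑ₙ' aₙ' b_{n−n'}` for absolutely summable `a, b`
  (`tsum_mul_tsum_of_summable_norm` and the shear `(n, n') ↦ (n', n − n')` of `ℤ × ℤ`);
* `hasDerivAt_tsum_fourier_smul` — termwise differentiation of `s ↦ ∑ₙ eₙ(ωs) • aₙ` for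
  `∑ |n|‖aₙ‖ < ∞` (`hasDerivAt_tsum`, `hasDerivAt_fourier`);
* fibre bookkeeping for lattice families with rapidly decaying extension to `ℤ⁴`.

References: Grafakos, *Classical Fourier Analysis* (2014), §3.3 (absolutely convergent Fourier
series, termwise differentiation); Constantin–Foias 1988, Ch. 8 (8.5) (the Galerkin system in
Fourier variables).
-/

noncomputable section

-- `Summit.<Summit>.<Problem>`: single-conjunct summit, the duplicate namespace is mandated (CONVENTIONS §2).
set_option linter.dupNamespace false

namespace Summit.AnomalousDissipation.AnomalousDissipation.Theorems.UniformWorkFloorTrap.WorkLipschitzCycles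

open scoped Topology ComplexConjugate
open Filter Set Function
open Literature.Analysis.FunctionSpaces Literature.Analysis.FunctionSpaces.Torus

/-! ## §1 The characters `eₙ` on the unit circle

`‖eₙ(x)‖ = 1` is the sibling lemma `Summit.AnomalousDissipation.AnomalousDissipation.Theorems.norm_fourier_apply`
(`TaylorCertificatesPacketLemmaFejer`), reused. -/

/-- `‖eₙ(x) zₙ‖ = ‖zₙ‖`. [folklore] -/
theorem norm_fourier_mul (n : ℤ) (x : UnitAddCircle) (z : ℂ) : ‖(fourier n x : ℂ) * z‖ = ‖z‖ := by
  rw [norm_mul, norm_fourier_apply, one_mul]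

/-- `‖eₙ(x) • v‖ = ‖v‖`. [folklore] -/
theorem norm_fourier_smul {V : Type*} [NormedAddCommGroup V] [NormedSpace ℂ V] (n : ℤ) (x : UnitAddCircle)
    (v : V) : ‖(fourier n x : ℂ) • v‖ = ‖v‖ := by
  rw [norm_smul, norm_fourier_apply, one_mul]

/-! ## §2 The Cauchy product of two absolutely convergent Fourier series on `ℤ` -/

/-- The shear `(n, n') ↦ (n', n − n')` of `ℤ × ℤ` (as `prodComm` followed by `prodShear` with
`Equiv.subRight`). [folklore] -/
theorem shear_int_apply (p : ℤ × ℤ) :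
    ((Equiv.prodComm ℤ ℤ).trans (Equiv.prodShear (Equiv.refl ℤ) Equiv.subRight)) p = (p.2, p.1 - p.2) := rfl

/-- **Cauchy product on `ℤ`** (with the reindexing shear `e (n, n') = (n', n − n')` as an explicit
argument): `(∑ₙ eₙ(x) aₙ)(∑ₙ eₙ(x) bₙ) = ∑ₙ eₙ(x) ∑ₙ' aₙ' b_{n−n'}` for absolutely summable `a, b`,
all series converging absolutely (Grafakos 2014, §3.3.3: product of absolutely convergent
Fourier series; `tsum_mul_tsum_of_summable_norm`, `Equiv.tsum_eq`, `Summable.tsum_prod`). [folklore] -/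
theorem tsum_fourier_mul_tsum_fourier_mul_of_shear (e : ℤ × ℤ ≃ ℤ × ℤ) (he' : ∀ p : ℤ × ℤ, e p = (p.2, p.1 - p.2))
    {a b : ℤ → ℂ} (ha : Summable fun n => ‖a n‖) (hb : Summable fun n => ‖b n‖) (x : UnitAddCircle) :
    (∑' n, (fourier n x : ℂ) * a n) * (∑' n, (fourier n x : ℂ) * b n) =
      ∑' n, (fourier n x : ℂ) * ∑' n', a n' * b (n - n') := by
  have ha' : Summable fun n => ‖(fourier n x : ℂ) * a n‖ := by simpa only [norm_fourier_mul] using ha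
  have hb' : Summable fun n => ‖(fourier n x : ℂ) * b n‖ := by simpa only [norm_fourier_mul] using hb
  rw [tsum_mul_tsum_of_summable_norm ha' hb']
  -- (no type ascription: unifying `‖?f z.1 * ?g z.2‖` against an ascribed type is pathological)
  have hF := ha'.mul_norm hb'
  have hphase : ∀ p : ℤ × ℤ, (fourier p.1 x : ℂ) = fourier p.2 x * fourier (p.1 - p.2) x := by
    intro p; rw [← fourier_add]; congr 1; abel
  have hFe : Summable fun p : ℤ × ℤ => (fourier p.1 x : ℂ) * (a p.2 * b (p.1 - p.2)) := by
    have h1 : Summable fun p : ℤ × ℤ => ‖(fourier (e p).1 x : ℂ) * a (e p).1 * ((fourier (e p).2 x : ℂ) * b (e p).2)‖ :=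
      (e.summable_iff (f := fun z : ℤ × ℤ => ‖(fourier z.1 x : ℂ) * a z.1 * ((fourier z.2 x : ℂ) * b z.2)‖)).2 hF
    refine (Summable.of_norm h1).congr fun p => ?_
    rw [he' p]
    simp only
    rw [hphase p]; ring
  calc ∑' z : ℤ × ℤ, (fourier z.1 x : ℂ) * a z.1 * ((fourier z.2 x : ℂ) * b z.2)
      = ∑' p : ℤ × ℤ, (fourier (e p).1 x : ℂ) * a (e p).1 * ((fourier (e p).2 x : ℂ) * b (e p).2) :=
        (e.tsum_eq (fun z : ℤ × ℤ => (fourier z.1 x : ℂ) * a z.1 * ((fourier z.2 x : ℂ) * b z.2))).symm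
    _ = ∑' p : ℤ × ℤ, (fourier p.1 x : ℂ) * (a p.2 * b (p.1 - p.2)) := by
        refine tsum_congr fun p => ?_
        rw [he' p]
        simp only
        rw [hphase p]; ring
    _ = ∑' n, ∑' n', (fourier n x : ℂ) * (a n' * b (n - n')) := by
        have h := hFe.tsum_prod
        exact h
    _ = ∑' n, (fourier n x : ℂ) * ∑' n', a n' * b (n - n') := by
        refine tsum_congr fun n => ?_
        rw [tsum_mul_left]

/-- **Cauchy product on `ℤ`**: for absolutely summable `a, b : ℤ → ℂ` and `x` on the unit circle,
`(∑ₙ eₙ(x) aₙ)(∑ₙ eₙ(x) bₙ) = ∑ₙ eₙ(x) ∑ₙ' aₙ' b_{n−n'}` (Grafakos 2014, §3.3.3). [folklore] -/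
theorem tsum_fourier_mul_tsum_fourier_mul {a b : ℤ → ℂ} (ha : Summable fun n => ‖a n‖)
    (hb : Summable fun n => ‖b n‖) (x : UnitAddCircle) :
    (∑' n, (fourier n x : ℂ) * a n) * (∑' n, (fourier n x : ℂ) * b n) =
      ∑' n, (fourier n x : ℂ) * ∑' n', a n' * b (n - n') :=
  tsum_fourier_mul_tsum_fourier_mul_of_shear _ shear_int_apply ha hb x

/-- The convolution bookkeeping with the shear as an explicit argument. [folklore] -/
theorem summable_convolution_int_of_shear (e : ℤ × ℤ ≃ ℤ × ℤ) (he' : ∀ p : ℤ × ℤ, e p = (p.2, p.1 - p.2))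
    {a b : ℤ → ℂ} (ha : Summable fun n => ‖a n‖) (hb : Summable fun n => ‖b n‖) :
    (Summable fun p : ℤ × ℤ => ‖a p.2 * b (p.1 - p.2)‖) ∧
    (∀ n, Summable fun n' => a n' * b (n - n')) ∧
    (Summable fun n => ‖∑' n', a n' * b (n - n')‖) := by
  have hF := ha.mul_norm hb
  have h1 : Summable fun p : ℤ × ℤ => ‖a p.2 * b (p.1 - p.2)‖ := by
    have := (e.summable_iff (f := fun z : ℤ × ℤ => ‖a z.1 * b z.2‖)).2 hF
    refine this.congr fun p => ?_
    simp only [Function.comp_apply, he' p]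
  refine ⟨h1, fun n => (Summable.of_norm h1).prod_factor n, ?_⟩
  refine Summable.of_nonneg_of_le (fun n => norm_nonneg _) (fun n => norm_tsum_le_tsum_norm ((h1.prod_factor n))) ?_
  exact h1.prod

/-- **The convolution on `ℤ` is absolutely summable in both variables**: for absolutely summable
`a, b : ℤ → ℂ`, `(n, n') ↦ aₙ' b_{n−n'}` is absolutely summable, hence so is each fibre and the
family of fibre sums. [folklore] -/
theorem summable_convolution_int {a b : ℤ → ℂ} (ha : Summable fun n => ‖a n‖) (hb : Summable fun n => ‖b n‖) :
    (Summable fun p : ℤ × ℤ => ‖a p.2 * b (p.1 - p.2)‖) ∧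
    (∀ n, Summable fun n' => a n' * b (n - n')) ∧
    (Summable fun n => ‖∑' n', a n' * b (n - n')‖) :=
  summable_convolution_int_of_shear _ shear_int_apply ha hb

/-! ## §3 Termwise differentiation of a vector-valued Fourier series in time -/

/-- **Termwise differentiation**: if `∑ ‖aₙ‖ < ∞` and `∑ |n| ‖aₙ‖ < ∞` then
`s ↦ ∑ₙ eₙ(ωs) • aₙ` is differentiable on `ℝ` with derivative `∑ₙ eₙ(ωt) • (2πiωn) • aₙ`
(Grafakos 2014, §3.3: termwise differentiation of absolutely convergent series; Mathlib
`hasDerivAt_tsum`, `hasDerivAt_fourier`). [folklore] -/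
theorem hasDerivAt_tsum_fourier_smul {a : ℤ → EuclideanSpace ℂ (Fin 3)} (ha : Summable fun n => ‖a n‖)
    (ha1 : Summable fun n : ℤ => ‖((n : ℤ) : ℂ)‖ * ‖a n‖) (ω t : ℝ) :
    HasDerivAt (fun s : ℝ => ∑' n : ℤ, (fourier n (((ω * s : ℝ)) : UnitAddCircle) : ℂ) • a n)
      (∑' n : ℤ, (fourier n (((ω * t : ℝ)) : UnitAddCircle) : ℂ) •
        ((2 * Real.pi * Complex.I * ω * n) • a n)) t := by
  -- each term and its derivative
  have hterm : ∀ (n : ℤ) (s : ℝ), HasDerivAt (fun y : ℝ => (fourier n (((ω * y : ℝ)) : UnitAddCircle) : ℂ) • a n)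
      ((fourier n (((ω * s : ℝ)) : UnitAddCircle) : ℂ) • ((2 * Real.pi * Complex.I * ω * n) • a n)) s := by
    intro n s
    have h1 := hasDerivAt_fourier 1 n (ω * s)
    have h2 : HasDerivAt (fun y : ℝ => ω * y) ω s := by
      simpa using (hasDerivAt_id s).const_mul ω
    have h3 := h1.scomp s h2
    have h4 := h3.smul_const (a n)
    have heq : (fun y : ℝ => (fourier n (((ω * y : ℝ)) : UnitAddCircle) : ℂ) • a n) =
        fun y => ((fun y : ℝ => fourier n ((y : ℝ) : AddCircle (1 : ℝ))) ∘ fun y : ℝ => ω * y) y • a n := by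
      funext y; rfl
    rw [heq]
    refine h4.congr_deriv ?_
    rw [smul_smul]
    congr 1
    rw [Complex.real_smul, Complex.ofReal_one, div_one]
    ring
  -- the summable bound on the derivatives
  have hbound : ∀ (n : ℤ) (s : ℝ), ‖(fourier n (((ω * s : ℝ)) : UnitAddCircle) : ℂ) •
      ((2 * Real.pi * Complex.I * ω * n) • a n)‖ ≤ 2 * Real.pi * |ω| * (‖((n : ℤ) : ℂ)‖ * ‖a n‖) := by
    intro n s
    rw [norm_fourier_smul, norm_smul]
    have : ‖(2 * Real.pi * Complex.I * ω * n : ℂ)‖ = 2 * Real.pi * |ω| * ‖((n : ℤ) : ℂ)‖ := by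
      rw [norm_mul, norm_mul, norm_mul, norm_mul, Complex.norm_I, mul_one, Complex.norm_real, Complex.norm_ofNat,
        Complex.norm_real, Real.norm_of_nonneg Real.pi_pos.le, Real.norm_eq_abs]
    rw [this]
    ring_nf
    exact le_rfl
  have hu : Summable fun n : ℤ => 2 * Real.pi * |ω| * (‖((n : ℤ) : ℂ)‖ * ‖a n‖) := ha1.mul_left _
  have h0 : Summable fun n : ℤ => (fourier n (((ω * t : ℝ)) : UnitAddCircle) : ℂ) • a n :=
    Summable.of_norm (by simpa only [norm_fourier_smul] using ha)
  exact hasDerivAt_tsum hu hterm hbound h0 t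

/-! ## §4 Fibres of lattice families with rapidly decaying extension -/

/-- **Fibre summability with the time weight**: if the extension `K ↦ c(K₀, tail K)` of a lattice
family `c` on `ℤ × ℤ³` to `ℤ⁴` decays rapidly, then for every spatial frequency `k` the time fibre
`n ↦ c(n,k)` satisfies `∑ₙ ‖c(n,k)‖ < ∞` and `∑ₙ |n| ‖c(n,k)‖ < ∞`, and the whole family is
absolutely summable on `ℤ × ℤ³` with the weight `1 + |n| + |k|²`. [folklore] -/
theorem summable_fibre_of_rapidDecayE {c : ℤ × (Fin 3 → ℤ) → EuclideanSpace ℂ (Fin 3)}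
    (hcr : RapidDecay (fun K : Fin 4 → ℤ => c (K 0, Fin.tail K))) :
    (Summable fun m : ℤ × (Fin 3 → ℤ) => (1 + |((m.1 : ℤ) : ℝ)| + freqNormSq m.2) * ‖c m‖) ∧
    (∀ k : Fin 3 → ℤ, Summable fun n : ℤ => ‖c (n, k)‖) ∧
    (∀ k : Fin 3 → ℤ, Summable fun n : ℤ => ‖(n : ℂ)‖ * ‖c (n, k)‖) := by
  -- the first moment on `ℤ⁴`, transported to `ℤ × ℤ³`
  have h1 : Summable fun m : ℤ × (Fin 3 → ℤ) => (1 + freqNormSq (Fin.cons m.1 m.2 : Fin 4 → ℤ)) ^ 1 *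
      ‖c ((Fin.cons m.1 m.2 : Fin 4 → ℤ) 0, Fin.tail (Fin.cons m.1 m.2 : Fin 4 → ℤ))‖ :=
    (summable_cons_iff (fun K : Fin 4 → ℤ => (1 + freqNormSq K) ^ 1 * ‖c (K 0, Fin.tail K)‖)).2 (hcr 1)
  simp only [Fin.cons_zero, Fin.tail_cons, Prod.mk.eta, pow_one, freqNormSq_cons] at h1
  have habs : ∀ n : ℤ, |((n : ℤ) : ℝ)| ≤ ((n : ℤ) : ℝ) ^ 2 := by
    intro n
    by_cases hn : n = 0
    · simp [hn]
    · have h1 : (1 : ℝ) ≤ |((n : ℤ) : ℝ)| := by exact_mod_cast Int.one_le_abs hn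
      calc |((n : ℤ) : ℝ)| = |((n : ℤ) : ℝ)| * 1 := (mul_one _).symm
        _ ≤ |((n : ℤ) : ℝ)| * |((n : ℤ) : ℝ)| := mul_le_mul_of_nonneg_left h1 (abs_nonneg _)
        _ = ((n : ℤ) : ℝ) ^ 2 := by rw [← sq, sq_abs]
  have hle : ∀ m : ℤ × (Fin 3 → ℤ), (1 + |((m.1 : ℤ) : ℝ)| + freqNormSq m.2) * ‖c m‖ ≤
      (1 + (((m.1 : ℤ) : ℝ) ^ 2 + freqNormSq m.2)) * ‖c m‖ := by
    intro m
    refine mul_le_mul_of_nonneg_right ?_ (norm_nonneg _)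
    linarith [habs m.1]
  have hnn : ∀ m : ℤ × (Fin 3 → ℤ), 0 ≤ (1 + |((m.1 : ℤ) : ℝ)| + freqNormSq m.2) * ‖c m‖ := fun m =>
    mul_nonneg (by linarith [abs_nonneg ((m.1 : ℤ) : ℝ), freqNormSq_nonneg m.2]) (norm_nonneg _)
  have hA : Summable fun m : ℤ × (Fin 3 → ℤ) => (1 + |((m.1 : ℤ) : ℝ)| + freqNormSq m.2) * ‖c m‖ :=
    Summable.of_nonneg_of_le hnn hle h1
  refine ⟨hA, fun k => ?_, fun k => ?_⟩
  · have h2 : Summable fun m : ℤ × (Fin 3 → ℤ) => ‖c m‖ :=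
      Summable.of_nonneg_of_le (fun m => norm_nonneg _)
        (fun m => by
          have : (1 : ℝ) ≤ 1 + |((m.1 : ℤ) : ℝ)| + freqNormSq m.2 := by
            linarith [abs_nonneg ((m.1 : ℤ) : ℝ), freqNormSq_nonneg m.2]
          nlinarith [norm_nonneg (c m)]) hA
    exact ((Equiv.prodComm ℤ (Fin 3 → ℤ)).symm.summable_iff.2 h2 |>.prod_factor k)
  · have h2 : Summable fun m : ℤ × (Fin 3 → ℤ) => ‖((m.1 : ℤ) : ℂ)‖ * ‖c m‖ :=
      Summable.of_nonneg_of_le (fun m => by positivity)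
        (fun m => by
          have : ‖((m.1 : ℤ) : ℂ)‖ ≤ 1 + |((m.1 : ℤ) : ℝ)| + freqNormSq m.2 := by
            rw [Complex.norm_intCast]
            linarith [freqNormSq_nonneg m.2]
          exact mul_le_mul_of_nonneg_right this (norm_nonneg _)) hA
    exact ((Equiv.prodComm ℤ (Fin 3 → ℤ)).symm.summable_iff.2 h2 |>.prod_factor k)



/-! ## §5 Registered tools stub -/

/-- **Registered tools stub** `stub_coeffCurveODETools` (line `work-lipschitz-cycles`, crux
`WazewskiBlock.UniformWorkFloorTrap`, stmt-AnomalousDissipation-10353): the Cauchy product on `ℤ`,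
termwise differentiation of vector-valued Fourier series in time, and fibre summability of lattice
families with rapidly decaying extension — the one-dimensional Fourier calculus consumed by
`stub_coeffCurveODE`. [folklore] -/
theorem stub_coeffCurveODETools :
    (∀ {a b : ℤ → ℂ}, (Summable fun n => ‖a n‖) → (Summable fun n => ‖b n‖) → ∀ x : UnitAddCircle,
      (∑' n, (fourier n x : ℂ) * a n) * (∑' n, (fourier n x : ℂ) * b n) =
        ∑' n, (fourier n x : ℂ) * ∑' n', a n' * b (n - n')) ∧
    (∀ {a : ℤ → EuclideanSpace ℂ (Fin 3)}, (Summable fun n => ‖a n‖) →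
      (Summable fun n : ℤ => ‖((n : ℤ) : ℂ)‖ * ‖a n‖) → ∀ ω t : ℝ,
      HasDerivAt (fun s : ℝ => ∑' n : ℤ, (fourier n (((ω * s : ℝ)) : UnitAddCircle) : ℂ) • a n)
        (∑' n : ℤ, (fourier n (((ω * t : ℝ)) : UnitAddCircle) : ℂ) •
          ((2 * Real.pi * Complex.I * ω * n) • a n)) t) ∧
    (∀ {c : ℤ × (Fin 3 → ℤ) → EuclideanSpace ℂ (Fin 3)},
      RapidDecay (fun K : Fin 4 → ℤ => c (K 0, Fin.tail K)) →
      (Summable fun m : ℤ × (Fin 3 → ℤ) => (1 + |((m.1 : ℤ) : ℝ)| + freqNormSq m.2) * ‖c m‖) ∧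
      (∀ k : Fin 3 → ℤ, Summable fun n : ℤ => ‖c (n, k)‖) ∧
      (∀ k : Fin 3 → ℤ, Summable fun n : ℤ => ‖(n : ℂ)‖ * ‖c (n, k)‖)) :=
  ⟨fun ha hb x => tsum_fourier_mul_tsum_fourier_mul ha hb x,
    fun ha ha1 ω t => hasDerivAt_tsum_fourier_smul ha ha1 ω t,
    fun hcr => summable_fibre_of_rapidDecayE hcr⟩

end Summit.AnomalousDissipation.AnomalousDissipation.Theorems.UniformWorkFloorTrap.WorkLipschitzCycles

end
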